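import Mathlib
import HarnessLib
import Literature.Analysis.FluidPDE.ClassicalSolution
import Literature.Analysis.FluidPDE.TaoLocalisation
import Literature.Analysis.FluidPDE.TaoEnstrophyLocalisationProofs
import Literature.Analysis.FluidPDE.CylinderAubinLions

/-!
# Shelf 1574, line `sparse_sieve`: the window law implies uniform local Type I — tools

Helper file (`--supports stmt-NavierStokesRegularity-1574 --as helper`) for the CHARACTERISATION converse
of `Cruxes/EnstrophyQuarterLaw/Lines/sparse_sieve.md` ("why this is the right cut"): the energy
`½`-Hölder window law `∫_a^b ∫ |curl u|² ≤ K √(b − a)` (`EnergyHalfHolder`, hence `EnstrophyQuarterLaw`)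
for ONE classical Leray–Hopf solution implies the line's stub S1 `UniformLocalTypeI T u` (uniform local
Type I in the Caffarelli–Kohn–Nirenberg quantities `A` and `E`). This part:

* `exists_seq_tendsto_of_ae_restrict_Ioo` — an a.e. property on an interval is met along a sequence IN
  the interval converging to any given point of the interval (`dense_of_ae`);
* `setLIntegral_ball_sq_le_of_ae` — for a field jointly continuous on `[0, T) × ℝ³`, an a.e.-in-time
  bound `∫_{B(x,R)} |u(t)|² ≤ C` on a time interval inside `[0, T)` holds at EVERY time of the interval
  (Fatou along such a sequence);
* `dissipation_cylinder_le_of_window` — the `E`-part VERBATIM: for `0 < R`, `R² ≤ b ≤ T`,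
  `∫_{b−R²}^{b} ∫_{B(x,R)} ‖∇u‖² ≤ K R` (operator norm ≤ Frobenius norm, whole-space div–curl estimate
  `∫ |∇u|² ≤ ∫ |curl u|²` as in the tree's `HolderBridge.lintegral_cylinder_frobeniusNormSq_le_of_window`,
  and the window law on `[b − R², b]`);
* `setLIntegral_ball_sq_le_of_bound` — the early-time `A`-bound from a sup bound: `|u t| ≤ V` on
  `B(x, R)`, `R ≤ r₀`, gives `∫_{B(x,R)} |u t|² ≤ (V² |B₁| r₀²) · R`.

HONEST FRAMING: elementary bookkeeping about ONE hypothetical solution; the window law is the OPEN crux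
`EnergyHalfHolder` (stmt-25161) / a consequence of the OPEN `EnstrophyQuarterLaw` (stmt-1574). Nothing
here bears on the regularity problem itself; no summit statement is proved.
-/

noncomputable section

-- the summit-side namespace repeats a component by design (D-0017)
set_option linter.dupNamespace false

namespace Summit.NavierStokesRegularity.NavierStokesRegularity.Theorems.EnstrophyQuarterLaw.LocalTypeI

open Set MeasureTheory Function Metric Filter Topology
open scoped ENNReal NNReal
open Literature.Analysis.FluidPDE

/-! ### From a.e. in time to every time, for continuous fields -/

/-- An a.e. property on an open interval is met along a sequence of points OF THE INTERVAL converging to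
any prescribed point of the interval (Lebesgue measure charges open sets, `Measure.dense_of_ae`; the tail
of the sequence lies in the open interval). [folklore] -/
theorem exists_seq_tendsto_of_ae_restrict_Ioo {P : ℝ → Prop} {a b t₀ : ℝ} (ht₀ : t₀ ∈ Ioo a b)
    (h : ∀ᵐ t ∂(volume.restrict (Ioo a b)), P t) :
    ∃ s : ℕ → ℝ, (∀ n, s n ∈ Ioo a b ∧ P (s n)) ∧ Tendsto s atTop (𝓝 t₀) := by
  rw [ae_restrict_iff' measurableSet_Ioo] at h
  have hdense : Dense {t : ℝ | t ∈ Ioo a b → P t} := Measure.dense_of_ae h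
  have hmem : t₀ ∈ closure {t : ℝ | t ∈ Ioo a b → P t} := by
    rw [hdense.closure_eq]; exact mem_univ _
  obtain ⟨s, hs, hst⟩ := mem_closure_iff_seq_limit.1 hmem
  have hev : ∀ᶠ n in atTop, s n ∈ Ioo a b := hst (isOpen_Ioo.mem_nhds ht₀)
  obtain ⟨N, hN⟩ := eventually_atTop.1 hev
  refine ⟨fun n => s (n + N), fun n => ⟨hN _ (Nat.le_add_left _ _), hs _ (hN _ (Nat.le_add_left _ _))⟩,
    hst.comp (tendsto_add_atTop_nat N)⟩

/-- **A.e.-in-time ball-energy bounds hold at every time, for jointly continuous fields.** If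
`uncurry u` is continuous on `[0, T) × ℝ³`, `(a, b) ⊆ [0, T)`, and `∫_{B(x,R)} ‖u t‖ₑ² ≤ C` for a.e.
`t ∈ (a, b)`, then the bound holds for EVERY `t ∈ (a, b)` (Fatou's lemma along a sequence of good times
converging to `t`, the integrands converging pointwise by continuity). [folklore] -/
theorem setLIntegral_ball_sq_le_of_ae {u : ℝ → EuclideanSpace ℝ (Fin 3) → EuclideanSpace ℝ (Fin 3)}
    {T a b : ℝ} (hcont : ContinuousOn (uncurry u) (Ico 0 T ×ˢ (univ : Set (EuclideanSpace ℝ (Fin 3)))))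
    (hab : Ioo a b ⊆ Ico 0 T) {x : EuclideanSpace ℝ (Fin 3)} {R : ℝ} {C : ℝ≥0∞}
    (h : ∀ᵐ t ∂(volume.restrict (Ioo a b)), ∫⁻ y in ball x R, ‖u t y‖ₑ ^ 2 ≤ C) :
    ∀ t ∈ Ioo a b, ∫⁻ y in ball x R, ‖u t y‖ₑ ^ 2 ≤ C := by
  intro t₀ ht₀
  obtain ⟨s, hs, hst⟩ := exists_seq_tendsto_of_ae_restrict_Ioo ht₀ h
  -- slices along the sequence are continuous
  have hslice : ∀ t ∈ Ico 0 T, Continuous (u t) := by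
    intro t ht
    have h1 : ContinuousOn (fun y : EuclideanSpace ℝ (Fin 3) => uncurry u (t, y)) univ :=
      hcont.comp (Continuous.continuousOn (by fun_prop)) (fun y _ => ⟨ht, mem_univ y⟩)
    exact continuousOn_univ.1 h1
  -- pointwise convergence of the integrands
  have hpt : ∀ y : EuclideanSpace ℝ (Fin 3),
      Tendsto (fun n => ‖u (s n) y‖ₑ ^ 2) atTop (𝓝 (‖u t₀ y‖ₑ ^ 2)) := by
    intro y
    have hcw : ContinuousWithinAt (uncurry u) (Ico 0 T ×ˢ univ) (t₀, y) :=
      hcont (t₀, y) ⟨hab ht₀, mem_univ _⟩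
    have hseq : Tendsto (fun n => (s n, y)) atTop (𝓝[Ico 0 T ×ˢ univ] (t₀, y)) :=
      tendsto_nhdsWithin_iff.2 ⟨hst.prodMk_nhds tendsto_const_nhds,
        Eventually.of_forall fun n => ⟨hab (hs n).1, mem_univ _⟩⟩
    have hu : Tendsto (fun n => u (s n) y) atTop (𝓝 (u t₀ y)) := hcw.tendsto.comp hseq
    exact ((ENNReal.continuous_pow 2).tendsto _).comp ((continuous_enorm.tendsto _).comp hu)
  have hmeas : ∀ n, AEMeasurable (fun y => ‖u (s n) y‖ₑ ^ 2) (volume.restrict (ball x R)) :=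
    fun n => ((hslice _ (hab (hs n).1)).measurable.enorm.pow_const 2).aemeasurable
  -- Fatou
  calc ∫⁻ y in ball x R, ‖u t₀ y‖ₑ ^ 2
      = ∫⁻ y in ball x R, liminf (fun n => ‖u (s n) y‖ₑ ^ 2) atTop := by
        refine lintegral_congr fun y => ?_
        rw [(hpt y).liminf_eq]
    _ ≤ liminf (fun n => ∫⁻ y in ball x R, ‖u (s n) y‖ₑ ^ 2) atTop := lintegral_liminf_le' hmeas
    _ ≤ C := liminf_le_of_frequently_le' (Frequently.of_forall fun n => (hs n).2)

/-! ### The `E`-part of `UniformLocalTypeI` from the window law -/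

/-- **Window law ⇒ uniform scaled dissipation (the `E`-part of `UniformLocalTypeI`, verbatim).** For a
classical solution on `[0, T)` (viscosity `ν > 0`), Leray–Hopf on `[0, T]`, with the window law
`∫_a^b ∫ |curl u|² ≤ K √(b − a)` for `0 ≤ a ≤ b ≤ T`: for every final time `0 < b ≤ T`, centre `x` and
radius `R > 0` with `R² ≤ b`, `∫_{b−R²}^{b} ∫_{B(x,R)} ‖∇u(t,y)‖² dy dt ≤ K · R` (operator norm of the
derivative; `‖∇u‖_op ≤ |∇u|_F`, `∫ |∇u(t)|²_F ≤ ∫ |curl u(t)|²` for the divergence-free finite-energy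
`C²` slices, and the window law on `[b − R², b]`, `√(R²) = R`). [folklore] -/
theorem dissipation_cylinder_le_of_window {ν T : ℝ}
    {u : ℝ → EuclideanSpace ℝ (Fin 3) → EuclideanSpace ℝ (Fin 3)} {p : ℝ → EuclideanSpace ℝ (Fin 3) → ℝ}
    (hν : 0 < ν) (hsol : IsClassicalNSSolutionOn (Ico 0 T) ν 0 u p) (hLH : IsLerayHopfOn T ν 0 (u 0) u)
    {K : ℝ} (hwin : ∀ a b : ℝ, 0 ≤ a → a ≤ b → b ≤ T →
      ∫⁻ t in Ioo a b, ∫⁻ x, ‖curl (u t) x‖ₑ ^ 2 ≤ ENNReal.ofReal (K * Real.sqrt (b - a)))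
    {b : ℝ} (hbT : b ≤ T) (x : EuclideanSpace ℝ (Fin 3)) {R : ℝ} (hR : 0 < R) (hRb : R ^ 2 ≤ b) :
    ∫⁻ t in Ioo (b - R ^ 2) b, ∫⁻ y in ball x R, ‖fderiv ℝ (u t) y‖ₑ ^ 2 ≤ ENNReal.ofReal (K * R) := by
  have ha : 0 ≤ b - R ^ 2 := sub_nonneg.2 hRb
  have hwin' := hwin (b - R ^ 2) b ha (by nlinarith) hbT
  rw [show b - (b - R ^ 2) = R ^ 2 by ring, Real.sqrt_sq hR.le] at hwin'
  refine le_trans ?_ hwin'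
  refine setLIntegral_mono_ae' measurableSet_Ioo (ae_of_all _ fun t ht => ?_)
  have htI : t ∈ Ico 0 T := ⟨ha.trans ht.1.le, lt_of_lt_of_le ht.2 hbT⟩
  have hC2 : ContDiff ℝ 2 (u t) := (hsol.contDiff_velocity htI).of_le (by norm_cast)
  have hL2 : ∫⁻ y, ‖u t y‖ₑ ^ 2 < ⊤ :=
    lt_of_le_of_lt (hLH.lintegral_enorm_sq_le hν.le ⟨htI.1, htI.2.le⟩) ENNReal.ofReal_lt_top
  calc ∫⁻ y in ball x R, ‖fderiv ℝ (u t) y‖ₑ ^ 2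
      ≤ ∫⁻ y, ‖fderiv ℝ (u t) y‖ₑ ^ 2 := setLIntegral_le_lintegral _ _
    _ ≤ ∫⁻ y, ENNReal.ofReal (frobeniusNormSq (fderiv ℝ (u t) y)) :=
        lintegral_mono fun y => enorm_pow_two_le_ofReal_frobeniusNormSq _
    _ ≤ ∫⁻ y, ‖curl (u t) y‖ₑ ^ 2 :=
        lintegral_frobeniusNormSq_fderiv_le_lintegral_sq_norm_curl hC2 (hsol.divFree t htI) hL2

/-! ### The early-time `A`-bound from a sup bound -/

/-- **Sup bound ⇒ scaled local energy bound.** If `‖u t y‖ ≤ V` on `B(x, R)` with `0 < R ≤ r₀`, then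
`∫_{B(x,R)} ‖u t‖ₑ² ≤ (V² · |B(0,1)| · r₀²) · R` (`|B(x,R)| = R³ |B(0,1)|` and `R³ ≤ r₀² R`). [folklore] -/
theorem setLIntegral_ball_sq_le_of_bound {u : ℝ → EuclideanSpace ℝ (Fin 3) → EuclideanSpace ℝ (Fin 3)}
    {t V r₀ R : ℝ} {x : EuclideanSpace ℝ (Fin 3)} (hR : 0 < R) (hRr : R ≤ r₀)
    (hb : ∀ y ∈ ball x R, ‖u t y‖ ≤ V) :
    ∫⁻ y in ball x R, ‖u t y‖ₑ ^ 2 ≤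
      ENNReal.ofReal (V ^ 2 * (volume (ball (0 : EuclideanSpace ℝ (Fin 3)) 1)).toReal * r₀ ^ 2 * R) := by
  set c₁ : ℝ := (volume (ball (0 : EuclideanSpace ℝ (Fin 3)) 1)).toReal with hc₁
  have hc₁0 : 0 ≤ c₁ := ENNReal.toReal_nonneg
  have hvol : volume (ball (0 : EuclideanSpace ℝ (Fin 3)) 1) = ENNReal.ofReal c₁ :=
    (ENNReal.ofReal_toReal measure_ball_lt_top.ne).symm
  have hpt : ∀ y ∈ ball x R, ‖u t y‖ₑ ^ 2 ≤ ENNReal.ofReal (V ^ 2) := by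
    intro y hy
    rw [← ofReal_norm, ← ENNReal.ofReal_pow (norm_nonneg _)]
    exact ENNReal.ofReal_le_ofReal (pow_le_pow_left₀ (norm_nonneg _) (hb y hy) 2)
  calc ∫⁻ y in ball x R, ‖u t y‖ₑ ^ 2
      ≤ ∫⁻ _ in ball x R, ENNReal.ofReal (V ^ 2) := setLIntegral_mono' measurableSet_ball
        (fun y hy => hpt y hy)
    _ = ENNReal.ofReal (V ^ 2) * volume (ball x R) := by rw [setLIntegral_const]
    _ = ENNReal.ofReal (V ^ 2) * (ENNReal.ofReal (R ^ 3) * ENNReal.ofReal c₁) := by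
        rw [Measure.addHaar_ball_of_pos volume x hR, finrank_euclideanSpace_fin, hvol]
    _ = ENNReal.ofReal (V ^ 2 * c₁ * R ^ 3) := by
        rw [← ENNReal.ofReal_mul (by positivity), ← ENNReal.ofReal_mul (by positivity)]
        ring_nf
    _ ≤ ENNReal.ofReal (V ^ 2 * c₁ * r₀ ^ 2 * R) := by
        refine ENNReal.ofReal_le_ofReal ?_
        have h3 : R ^ 3 ≤ r₀ ^ 2 * R := by
          have : R ^ 2 ≤ r₀ ^ 2 := pow_le_pow_left₀ hR.le hRr 2
          nlinarith
        have hc : 0 ≤ V ^ 2 * c₁ := by positivity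
        nlinarith

end Summit.NavierStokesRegularity.NavierStokesRegularity.Theorems.EnstrophyQuarterLaw.LocalTypeI

end
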